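import Mathlib
import HarnessLib

/-!
# The Faà di Bruno bound for FACTORIAL-geometric jets on BOTH sides:
# `‖Dᵏg(f x)‖ ≤ A·(k+s)!·τᵏ`, `‖Dⁱf(x)‖ ≤ B·i!·σⁱ` ⇒ `‖Dⁿ(g ∘ f)(x)‖ ≤ A·(n+s)!·(4σ(1+τB))ⁿ`

Topic `Analysis/Calculus`; companion of `IteratedDerivCompGeometric` (outer factorial-geometric, inner PURE geometric) and of Mathlib's
`norm_iteratedFDeriv_comp_le` (outer uniform, inner pure power).  Those bounds lose a factor `n!` each time the INNER function has factorially growing jets —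
which is the generic situation for a smooth non-polynomial inner function (a cutoff composed with a band, the shifted band `u + w(u)·v` of the resummed
ultraviolet symbol; Benfatto–Giuliani–Mastropietro 2006 §2.2–2.3, cell gate-hubbard-kl memo SUP-ROUTE-SPEC §2(c)): composing twice or thrice produces
`(n!)²`, `(n!)³`, …, and forcing such jets into the pure-power slot produces `(n!)^{2n}`.  The classical fact that factorial-geometric (Gevrey-1) jets are CLOSED
under composition, with a single factorial, follows from the chain rule `D(g∘f) = (Dg∘f)·Df` by induction on the order, SHIFTING the factorial of the outer
family (`Dg` has jets `A(k+1+s)!τ^{k+1}`) and Leibniz (`ContinuousLinearMap.norm_iteratedFDeriv_le_of_bilinear` for the composition of linear maps):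
the recurrence closes because `Σ_{m≥0} (m+1)·τB·(σ/θ)^{m+1} ≤ 4/9 < 1` for `θ = 4σ(1+τB)`.

* `sum_range_succ_mul_geometric_le` — `Σ_{m≤n} (m+1)·r^{m+1} ≤ r/(1−r)²` (`0 ≤ r < 1`);
* **`norm_iteratedFDeriv_comp_le_of_factorial`** — the bound above, at a point, for `C^∞` maps between real normed spaces (shift `s` arbitrary).

Everything is proved; no definitions; no named facts.

## Sources

G. Benfatto, A. Giuliani, V. Mastropietro, Ann. Henri Poincaré 7 (2006) 809–898, §3 (3.2)–(3.8) (`BenfattoGiulianiMastropietro2006`); the chain rule and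
Leibniz bounds are Mathlib's (`fderiv_comp`, `ContinuousLinearMap.norm_iteratedFDeriv_le_of_bilinear`, `norm_iteratedFDeriv_fderiv`).
-/

noncomputable section

namespace Literature.Analysis.Calculus

open Finset
open scoped Nat

/-- `Σ_{m ≤ n} (m+1)·r^{m+1} ≤ r/(1−r)²` for `0 ≤ r < 1` (partial sums of `Σ (m+1)r^{m+1} = r/(1−r)²`). [cite: BenfattoGiulianiMastropietro2006, §3 (3.2)] -/
theorem sum_range_succ_mul_geometric_le {r : ℝ} (hr0 : 0 ≤ r) (hr1 : r < 1) (n : ℕ) :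
    ∑ m ∈ range (n + 1), ((m : ℝ) + 1) * r ^ (m + 1) ≤ r / (1 - r) ^ 2 := by
  have h1r : 0 < 1 - r := by linarith
  -- closed form of the partial sum times (1-r)²: induction
  have key : ∀ n : ℕ, (1 - r) ^ 2 * ∑ m ∈ range (n + 1), ((m : ℝ) + 1) * r ^ (m + 1) = r - (n + 2 : ℝ) * r ^ (n + 2) + (n + 1 : ℝ) * r ^ (n + 3) := by
    intro n
    induction n with
    | zero => simp; ring
    | succ k ih =>
      rw [sum_range_succ, mul_add, ih]
      push_cast
      ring
  have hle : (1 - r) ^ 2 * ∑ m ∈ range (n + 1), ((m : ℝ) + 1) * r ^ (m + 1) ≤ r := by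
    rw [key]
    have h2 : (n + 1 : ℝ) * r ^ (n + 3) ≤ (n + 2 : ℝ) * r ^ (n + 2) := by
      rw [show n + 3 = (n + 2) + 1 by ring, pow_succ]
      have hp : 0 ≤ r ^ (n + 2) := by positivity
      have hle1 : r ^ (n + 2) * r ≤ r ^ (n + 2) := mul_le_of_le_one_right hp hr1.le
      have hn0 : (0 : ℝ) ≤ n := Nat.cast_nonneg n
      nlinarith [mul_nonneg hp hr0]
    linarith
  rw [le_div_iff₀ (by positivity)]
  linarith [hle]

universe u

variable {E : Type*} [NormedAddCommGroup E] [NormedSpace ℝ E]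

/-- **COMPOSITION OF FACTORIAL-GEOMETRIC JETS.**  Let `f : E → F` and `g : F → G` be `C^∞` (`F`, `G` real normed spaces).  If at `x`
`‖Dⁱf(x)‖ ≤ B·i!·σⁱ` for `1 ≤ i ≤ n` and `‖Dᵏg(f x)‖ ≤ A·(k+s)!·τᵏ` for `k ≤ n` (`A, B, σ, τ ≥ 0`, `s : ℕ` a shift), then
`‖Dⁿ(g ∘ f)(x)‖ ≤ A·(n+s)!·(4σ(1+τB))ⁿ`.  (At `s = 0`: outer jets `A·k!·τᵏ` give `A·n!·(4σ(1+τB))ⁿ` — ONE factorial.)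
[cite: BenfattoGiulianiMastropietro2006, §3 (3.2)] -/
theorem norm_iteratedFDeriv_comp_le_of_factorial {F G : Type u} [NormedAddCommGroup F] [NormedSpace ℝ F] [NormedAddCommGroup G] [NormedSpace ℝ G]
    {f : E → F} (hf : ContDiff ℝ (⊤ : ℕ∞) f) (x : E) {B σ τ : ℝ} (hB : 0 ≤ B) (hσ : 0 ≤ σ) (hτ : 0 ≤ τ) (n : ℕ)
    (hDf : ∀ i, 1 ≤ i → i ≤ n → ‖iteratedFDeriv ℝ i f x‖ ≤ B * i ! * σ ^ i)
    {g : F → G} (hg : ContDiff ℝ (⊤ : ℕ∞) g) (A : ℝ) (s : ℕ)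
    (hDg : ∀ k ≤ n, ‖iteratedFDeriv ℝ k g (f x)‖ ≤ A * (k + s) ! * τ ^ k) :
    ‖iteratedFDeriv ℝ n (g ∘ f) x‖ ≤ A * (n + s) ! * (4 * σ * (1 + τ * B)) ^ n := by
  -- strong induction on `n`, generalising the target space, the outer function, its amplitude and the shift
  induction n using Nat.strong_induction_on generalizing G g A s with
  | _ n ih =>
    rcases n with _ | n
    · -- order 0
      have h0 := hDg 0 le_rfl
      simp only [pow_zero, mul_one, zero_add] at h0 ⊢
      rw [norm_iteratedFDeriv_zero, Function.comp_apply]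
      rw [norm_iteratedFDeriv_zero] at h0
      exact h0
    · -- order n+1: `D^{n+1}(g∘f) = Dⁿ[(Dg∘f)∘L Df]`
      have hA : 0 ≤ A := by
        have h0 := hDg 0 (Nat.zero_le _)
        rw [norm_iteratedFDeriv_zero, pow_zero, mul_one] at h0
        exact nonneg_of_mul_nonneg_left ((norm_nonneg _).trans h0) (by positivity)
      set θ : ℝ := 4 * σ * (1 + τ * B) with hθ
      have hθ0 : 0 ≤ θ := by rw [hθ]; positivity
      -- the derivative as a bilinear expression
      have hf1 : ContDiff ℝ (⊤ : ℕ∞) (fderiv ℝ f) := hf.fderiv_right le_rfl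
      have hg1 : ContDiff ℝ (⊤ : ℕ∞) (fderiv ℝ g) := hg.fderiv_right le_rfl
      have hg1f : ContDiff ℝ (⊤ : ℕ∞) (fun y => fderiv ℝ g (f y)) := hg1.comp hf
      have hderiv : fderiv ℝ (g ∘ f) = fun y => ContinuousLinearMap.compL ℝ E F G (fderiv ℝ g (f y)) (fderiv ℝ f y) := by
        funext y
        rw [ContinuousLinearMap.compL_apply]
        exact fderiv_comp y (hg.differentiable (by simp) _) (hf.differentiable (by simp) _)
      rw [← norm_iteratedFDeriv_fderiv, hderiv]
      refine ((ContinuousLinearMap.compL ℝ E F G).norm_iteratedFDeriv_le_of_bilinear hg1f hf1 x (n := n) (by exact_mod_cast le_top)).trans ?_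
      -- each term: IH for `Dg ∘ f` (shift `s+1`, amplitude `Aτ`), hypothesis for `Df`
      have hterm : ∀ i ∈ range (n + 1), (n.choose i : ℝ) * ‖iteratedFDeriv ℝ i (fun y => fderiv ℝ g (f y)) x‖ *
          ‖iteratedFDeriv ℝ (n - i) (fderiv ℝ f) x‖ ≤
          A * (n + 1 + s) ! * θ ^ (n + 1) * (τ * B * (((n - i : ℕ) : ℝ) + 1) * (σ / θ) ^ (n - i + 1)) := by
        intro i hi
        have hin : i ≤ n := Nat.lt_succ_iff.1 (mem_range.1 hi)
        -- IH at order `i` for the outer function `fderiv g` with shift `s+1` and amplitude `A·τ`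
        have hIH : ‖iteratedFDeriv ℝ i ((fun z => fderiv ℝ g z) ∘ f) x‖ ≤ A * τ * (i + (s + 1)) ! * θ ^ i := by
          refine ih i (Nat.lt_succ_of_le hin) (fun j hj1 hji => hDf j hj1 (hji.trans (Nat.le_succ_of_le hin))) hg1 (A * τ) (s + 1) ?_
          intro k hk
          rw [norm_iteratedFDeriv_fderiv]
          refine (hDg (k + 1) (by omega)).trans (le_of_eq ?_)
          rw [show k + 1 + s = k + (s + 1) by ring, pow_succ]
          ring
        have hDf' : ‖iteratedFDeriv ℝ (n - i) (fderiv ℝ f) x‖ ≤ B * (n - i + 1) ! * σ ^ (n - i + 1) := by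
          rw [norm_iteratedFDeriv_fderiv]
          exact hDf (n - i + 1) (by omega) (by omega)
        -- the factorial comparison `C(n,i)·(i+s+1)!·(n−i+1)! ≤ (n−i+1)·(n+1+s)!`
        have hfac : (n.choose i : ℝ) * ((i + (s + 1)) ! : ℝ) * ((n - i + 1) ! : ℝ) ≤ (((n - i : ℕ) : ℝ) + 1) * ((n + 1 + s) ! : ℝ) := by
          -- `C(n,i)·(n−i+1)! = (n−i+1)·n!/i!` and `(i+s+1)!/i! ≤ (n+s+1)!/n!`
          have h1 : (n.choose i : ℝ) * ((n - i + 1) ! : ℝ) * (i ! : ℝ) = (((n - i : ℕ) : ℝ) + 1) * (n ! : ℝ) := by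
            have h := Nat.choose_mul_factorial_mul_factorial hin
            have h' : ((n.choose i : ℕ) : ℝ) * (i ! : ℝ) * ((n - i) ! : ℝ) = n ! := by exact_mod_cast h
            rw [Nat.factorial_succ]
            push_cast
            nlinarith [h']
          have h2 : ((i + (s + 1)) ! : ℝ) * (n ! : ℝ) ≤ ((n + 1 + s) ! : ℝ) * (i ! : ℝ) := by
            -- `(i+s+1)!/i! = ∏_{j=1}^{s+1}(i+j) ≤ ∏_{j=1}^{s+1}(n+j) = (n+s+1)!/n!`
            have key : ∀ t : ℕ, (i + t) ! * n ! ≤ (n + t) ! * i ! := by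
              intro t
              induction t with
              | zero => simp [mul_comm]
              | succ t iht =>
                rw [show i + (t + 1) = (i + t) + 1 by ring, show n + (t + 1) = (n + t) + 1 by ring, Nat.factorial_succ, Nat.factorial_succ,
                  mul_assoc, mul_assoc]
                exact Nat.mul_le_mul (by omega) iht
            have := key (s + 1)
            rw [show n + 1 + s = n + (s + 1) by ring]
            exact_mod_cast this
          have hi0 : (0 : ℝ) < i ! := by exact_mod_cast Nat.factorial_pos i
          have hn0 : (0 : ℝ) < n ! := by exact_mod_cast Nat.factorial_pos n
          -- combine: multiply the target by `i!·n!`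
          have h3 : (n.choose i : ℝ) * ((i + (s + 1)) ! : ℝ) * ((n - i + 1) ! : ℝ) * ((i ! : ℝ) * (n ! : ℝ)) ≤
              (((n - i : ℕ) : ℝ) + 1) * ((n + 1 + s) ! : ℝ) * ((i ! : ℝ) * (n ! : ℝ)) := by
            calc (n.choose i : ℝ) * ((i + (s + 1)) ! : ℝ) * ((n - i + 1) ! : ℝ) * ((i ! : ℝ) * (n ! : ℝ))
                = ((n.choose i : ℝ) * ((n - i + 1) ! : ℝ) * (i ! : ℝ)) * (((i + (s + 1)) ! : ℝ) * (n ! : ℝ)) := by ring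
              _ = ((((n - i : ℕ) : ℝ) + 1) * (n ! : ℝ)) * (((i + (s + 1)) ! : ℝ) * (n ! : ℝ)) := by rw [h1]
              _ ≤ ((((n - i : ℕ) : ℝ) + 1) * (n ! : ℝ)) * (((n + 1 + s) ! : ℝ) * (i ! : ℝ)) := by gcongr
              _ = (((n - i : ℕ) : ℝ) + 1) * ((n + 1 + s) ! : ℝ) * ((i ! : ℝ) * (n ! : ℝ)) := by ring
          exact le_of_mul_le_mul_right h3 (by positivity)
        -- powers: `θ^i σ^{n−i+1} = θ^{n+1} (σ/θ)^{n−i+1}` when `θ > 0`; if `θ = 0` then `σ = 0` and both sides vanish for `n - i + 1 ≥ 1`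
        by_cases hσ0 : σ = 0
        · have : σ ^ (n - i + 1) = 0 := by rw [hσ0]; exact zero_pow (by omega)
          calc (n.choose i : ℝ) * ‖iteratedFDeriv ℝ i (fun y => fderiv ℝ g (f y)) x‖ * ‖iteratedFDeriv ℝ (n - i) (fderiv ℝ f) x‖
              ≤ (n.choose i : ℝ) * (A * τ * (i + (s + 1)) ! * θ ^ i) * (B * (n - i + 1) ! * σ ^ (n - i + 1)) := by gcongr; exact hIH
            _ = 0 := by rw [this]; ring
            _ ≤ _ := by positivity
        have hσp : 0 < σ := lt_of_le_of_ne hσ (Ne.symm hσ0)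
        have hθp : 0 < θ := by rw [hθ]; positivity
        have hpow : θ ^ i * σ ^ (n - i + 1) = θ ^ (n + 1) * (σ / θ) ^ (n - i + 1) := by
          rw [div_pow, show n + 1 = i + (n - i + 1) by omega, pow_add]
          field_simp
          rw [← pow_add]
        calc (n.choose i : ℝ) * ‖iteratedFDeriv ℝ i (fun y => fderiv ℝ g (f y)) x‖ * ‖iteratedFDeriv ℝ (n - i) (fderiv ℝ f) x‖
            ≤ (n.choose i : ℝ) * (A * τ * (i + (s + 1)) ! * θ ^ i) * (B * (n - i + 1) ! * σ ^ (n - i + 1)) := by gcongr; exact hIH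
          _ = A * (τ * B) * ((n.choose i : ℝ) * ((i + (s + 1)) ! : ℝ) * ((n - i + 1) ! : ℝ)) * (θ ^ i * σ ^ (n - i + 1)) := by ring
          _ ≤ A * (τ * B) * ((((n - i : ℕ) : ℝ) + 1) * ((n + 1 + s) ! : ℝ)) * (θ ^ i * σ ^ (n - i + 1)) := by gcongr
          _ = A * (n + 1 + s) ! * θ ^ (n + 1) * (τ * B * (((n - i : ℕ) : ℝ) + 1) * (σ / θ) ^ (n - i + 1)) := by rw [hpow]; ring
      -- sum the geometric-arithmetic series
      have hS : ∑ i ∈ range (n + 1), τ * B * (((n - i : ℕ) : ℝ) + 1) * (σ / θ) ^ (n - i + 1) ≤ 4 / 9 := by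
        by_cases hσ0 : σ = 0
        · have hz : ∀ i ∈ range (n + 1), τ * B * (((n - i : ℕ) : ℝ) + 1) * (σ / θ) ^ (n - i + 1) = 0 := by
            intro i _; rw [hσ0, zero_div, zero_pow (by omega)]; ring
          rw [sum_congr rfl hz, sum_const_zero]; norm_num
        have hσp : 0 < σ := lt_of_le_of_ne hσ (Ne.symm hσ0)
        have hθp : 0 < θ := by rw [hθ]; positivity
        set r : ℝ := σ / θ with hr
        have hr0 : 0 ≤ r := by positivity
        have hr_eq : r = 1 / (4 * (1 + τ * B)) := by rw [hr, hθ]; field_simp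
        have h1tb : 1 ≤ 1 + τ * B := le_add_of_nonneg_right (by positivity)
        have hr4 : r ≤ 1 / 4 := by rw [hr_eq]; rw [div_le_div_iff₀ (by positivity) (by norm_num)]; linarith
        have hr1 : r < 1 := by linarith
        -- reindex `m = n - i`
        have hreindex : ∑ i ∈ range (n + 1), τ * B * (((n - i : ℕ) : ℝ) + 1) * r ^ (n - i + 1) =
            τ * B * ∑ m ∈ range (n + 1), ((m : ℝ) + 1) * r ^ (m + 1) := by
          rw [mul_sum]
          rw [← sum_range_reflect]
          refine sum_congr rfl fun i hi => ?_
          have hin : i ≤ n := Nat.lt_succ_iff.1 (mem_range.1 hi)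
          rw [show n + 1 - 1 - i = n - i by omega, show n - (n - i) = i by omega]
          ring
        rw [hreindex]
        have hgeo := sum_range_succ_mul_geometric_le hr0 hr1 n
        have h34 : (3 / 4 : ℝ) ≤ 1 - r := by linarith
        have hden : r / (1 - r) ^ 2 ≤ r / (3 / 4) ^ 2 := div_le_div_of_nonneg_left hr0 (by positivity) (pow_le_pow_left₀ (by norm_num) h34 2)
        have htb : τ * B * (r / (3 / 4) ^ 2) ≤ 4 / 9 := by
          rw [hr_eq]
          have : τ * B * (1 / (4 * (1 + τ * B)) / (3 / 4) ^ 2) = (4 / 9) * (τ * B / (1 + τ * B)) := by field_simp; ring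
          rw [this]
          have hfrac : τ * B / (1 + τ * B) ≤ 1 := by rw [div_le_one (by positivity)]; linarith
          linarith
        calc τ * B * ∑ m ∈ range (n + 1), ((m : ℝ) + 1) * r ^ (m + 1) ≤ τ * B * (r / (1 - r) ^ 2) :=
              mul_le_mul_of_nonneg_left hgeo (by positivity)
          _ ≤ τ * B * (r / (3 / 4) ^ 2) := mul_le_mul_of_nonneg_left hden (by positivity)
          _ ≤ 4 / 9 := htb
      refine (mul_le_mul (ContinuousLinearMap.norm_compL_le ℝ E F G) (sum_le_sum hterm) (sum_nonneg fun i _ => by positivity)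
        zero_le_one).trans ?_
      rw [one_mul, ← mul_sum]
      calc A * (n + 1 + s) ! * θ ^ (n + 1) * ∑ i ∈ range (n + 1), τ * B * (((n - i : ℕ) : ℝ) + 1) * (σ / θ) ^ (n - i + 1)
          ≤ A * (n + 1 + s) ! * θ ^ (n + 1) * 1 := by
            refine mul_le_mul_of_nonneg_left (hS.trans (by norm_num)) (by positivity)
        _ = A * (n + 1 + s) ! * θ ^ (n + 1) := mul_one _

end Literature.Analysis.Calculus

end
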